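import Summits.BirchSwinnertonDyer.BirchSwinnertonDyer.Theorems.KatoDescentPotSupersingularFineSelmerDescentOfDivisibility
import Literature.NumberTheory.EllipticCurves.Kato2004.FineSelmerDualTorsionOfEulerSystemBoundProofs
import Literature.NumberTheory.EllipticCurves.Kato2004.Condition1252
import Literature.NumberTheory.EllipticCurves.KatoFineSelmerFiniteProofs
import Literature.NumberTheory.EllipticCurves.NonEisensteinPrimeOfSurjective
import HarnessLib

/-!
# Kato's Thm. 14.5 (3) on the fine road, `Γ`-level and level 0, on the BIG-IMAGE rows (Kato's (12.5.2):
# `Im ρ_{E,p} ⊇ SL₂(ℤ_p)`), modulo the Thm. 13.4 fact ONLY — the μ-free descent of clause (3)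

Seat `bsd-potss-rkm` g16 (prover; cell `bsd-potss`).  Courtesy file for the IRREDUCIBLE (big-image) rows of the cell's
Kato-descent routes (K9 `WildLowerHalfRankZero` stmt-BirchSwinnertonDyer-19195 / K8-t′ `TameLowerHalfRankZero` 19981, whose
Kato half is today the cite-level fact A161 `Kato2004.rankZero_padicValNat_sha_add_padicValNat_tamagawa_le_of_additive_potGood_of_imageContainsSL2`);
`--supports … --as helper`; closes nothing; ROUTE-FREE.  HONEST FRAMING: BSD is not proved by any of this; nothing is booked.

WHAT.  The row-free descent of `…FineSelmerDescentOfDivisibility` asked for `Sel₀(W/ℚ_∞)[p]` finite (`μ(X₀) = 0`) to know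
`X₀` finitely generated and torsion.  Both are theorems WITHOUT `μ`: `X₀` is ALWAYS finitely generated
(`FineSelmerDualData.module_finite`, Coates–Sujatha §3 / Nakayama) and it is torsion as soon as ONE genuine Euler-system class
with `𝐇¹_Γ/Λs` torsion exists under hypothesis (v) (`Kato2004.isTorsion_fineSelmerDual_of_thm13_4`, k8q-c2x g7).  So:

* §1 `natCard_fineSelmer_invariants_mul_descentCokernel_dvd_of_charIdeal_le'` / `natCard_fineSelmerZero_…'` — the row-free
  descent with inputs {`X₀` torsion, `proj₀ s` of infinite order on a rank-0 row, `char_Λ(𝐇¹_Γ/Λs) ⊆ char_Λ X₀`} (finite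
  generation supplied): `#Sel₀(W/ℚ_∞)^Γ · #desc ∣ #Sel₀(W/ℚ_∞)_Γ · [A : ℤ_p s₀]` and
  `#Sel₀(ℚ, W[p^∞]) · #desc ∣ #W[p^∞]^{Γ_ℚ} · #Sel₀(W/ℚ_∞)_Γ · [A : ℤ_p s₀]`.
* §2 `…_of_imageContainsSL2` — on a rank-0 row with Kato's (12.5.2) (`ImageContainsSL2 W p`; for `p ≥ 5` ⟺ `ρ̄_{W,p}` onto,
  `imageContainsSL2_iff_hasSurjectiveModNGaloisRep`), `p ≠ 2`, for ANY genuine Λ-adic Euler-system class `s` with `proj₀ s` of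
  infinite order: clause (3) of Thm. 13.4 (its `σ` with `Coker(ρ(σ) − 1) ≅ ℤ_p` from `exists_quotient_range_sub_one_equiv_of_imageContainsSL2`;
  hypothesis (v) from the same `σ`) gives `ℓ_𝔭(X₀) ≤ ℓ_𝔭(𝐇¹_Γ/Λs)` at EVERY height-one prime — including `(p)`, so NO `μ`-input
  is needed — hence the divisibility and both conclusions, MODULO `thm13_4_…` ALONE.  This is the Iwasawa-theoretic half of
  A161 (Kato Thm. 12.5 (4) + 14.5 (3)) as a KERNEL theorem down to level 0; its other half is the same level-0 Poitou–Tate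
  count as for crux M (memo `FINDING-19196-rkm-g16.md`).

References: [Kato2004Asterisque] Thm. 12.5 (4) with (12.5.2) (p. 222), Thm. 13.4 (3) (p. 226), Thm. 14.5 (3) (p. 236), §14.14
(pp. 243–244); [GreenbergLNM1716] §4 Lemmas 4.2–4.3; [CoatesSujatha2005] §3.
-/

-- the summit and its single problem are both named `BirchSwinnertonDyer` (registry layout D-0017)
set_option linter.dupNamespace false
set_option autoImplicit false

noncomputable section

open scoped NumberField
open Field IsDedekindDomain WeierstrassCurve
open Literature.NumberTheory.GaloisRepresentations Literature.NumberTheory.EllipticCurves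
open Literature.NumberTheory.EllipticCurves.GreenbergSelmer
open Literature.NumberTheory.EllipticCurves.Kato2004 Literature.NumberTheory.EllipticCurves.Kato2004.EulerSystemValues
open Literature.NumberTheory.EllipticCurves.IwasawaAlgebra Literature.NumberTheory.EllipticCurves.IwasawaDual

namespace Summit.BirchSwinnertonDyer.BirchSwinnertonDyer.Theorems.FineSelmerDescentOfDivisibility

/-! ## §1 Row-free descent, `μ`-free hypotheses -/

section RowFree

variable (W : WeierstrassCurve ℚ) [W.IsElliptic] (p : ℕ) [Fact p.Prime]
  [ContinuousSMul ℤ_[p] (W.tateModule p)]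
  [Finite W.toAffine.Point] [Finite (AddCommGroup.primaryComponent W.sha p)]
  {κ : ZpExtension ℚ p} {γ : absoluteGaloisGroup ℚ}

/-- **Descent of `char_Λ(𝐇¹_Γ/Λs) ⊆ char_Λ X₀` to the `Γ`-(co)invariants, row-free, `μ`-free hypotheses**: `X₀` torsion
(finite generation is a theorem), `proj₀ s` of infinite order on a rank-0 row, and the divisibility ⟹ `Sel₀(W/ℚ_∞)^Γ`,
`Sel₀(W/ℚ_∞)_Γ`, the descent cokernel and `H¹(ℤ[1/p],T_pW)/ℤ_p s₀` finite and
`#Sel₀(W/ℚ_∞)^Γ · #(H¹(ℤ[1/p],T_pW)/proj₀(𝐇¹_Γ/T)) ∣ #Sel₀(W/ℚ_∞)_Γ · [H¹(ℤ[1/p],T_pW) : ℤ_p s₀]`.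
[cite: Kato2004Asterisque, Thm. 14.5 (3) (p. 236), §14.14 and Lemma 14.15 (pp. 243–244)] [cite: GreenbergLNM1716, §4 Lemma 4.2 (p. 102)] -/
theorem natCard_fineSelmer_invariants_mul_descentCokernel_dvd_of_charIdeal_le' (hκ : κ.IsCyclotomic)
    (hγ : κ.IsTopGenerator γ) (I : IwasawaH1Data W p κ γ) (Y : W.FineSelmerDualData κ γ)
    (hYtors : Module.IsTorsion (IwasawaAlgebra p) Y.X) (s : I.H) (hnt : ¬ IsOfFinAddOrder (I.proj 0 s))
    (hchar : Module.charIdeal (IwasawaAlgebra p) (I.H ⧸ Submodule.span (IwasawaAlgebra p) {s}) ≤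
      Module.charIdeal (IwasawaAlgebra p) Y.X) :
    Finite (endInvariants (W.conjFineSelmerInfty κ γ - 1)) ∧
      Finite (EndCoinvariants (W.conjFineSelmerInfty κ γ - 1)) ∧ Finite I.descentCokernel ∧
      Finite (integralH1 (tateRep W p) p (κ.layerSubgroup 0) ⧸
        Submodule.span ℤ_[p] {(⟨I.proj 0 s, I.proj_mem 0 s⟩ : integralH1 (tateRep W p) p (κ.layerSubgroup 0))}) ∧
      Nat.card (endInvariants (W.conjFineSelmerInfty κ γ - 1)) * Nat.card I.descentCokernel ∣
        Nat.card (EndCoinvariants (W.conjFineSelmerInfty κ γ - 1)) *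
          Nat.card (integralH1 (tateRep W p) p (κ.layerSubgroup 0) ⧸
            Submodule.span ℤ_[p] {(⟨I.proj 0 s, I.proj_mem 0 s⟩ :
              integralH1 (tateRep W p) p (κ.layerSubgroup 0))}) := by
  have hs0 : s ≠ 0 := by
    rintro rfl
    exact hnt (by rw [map_zero]; exact isOfFinAddOrder_iff_nsmul_eq_zero.mpr ⟨1, one_pos, by simp⟩)
  haveI : Module.Finite (IwasawaAlgebra p) I.H := IwasawaH1Data.module_finite_of_isCyclotomic hκ hγ I
  haveI := I.noZeroSMulDivisors hγ
  have htors : Module.IsTorsion (IwasawaAlgebra p) (I.H ⧸ Submodule.span (IwasawaAlgebra p) {s}) :=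
    ReducibleZetaDivisibility.isTorsion_quotient_span_singleton_of_ne_zero W p hκ hγ I hs0
  haveI : Module.Finite (IwasawaAlgebra p) Y.X := FineSelmerDualData.module_finite W κ hγ Y
  obtain ⟨-, hfinN⟩ := ReducibleFineSelmerDescentCount.finite_coinvariants_quotient_span_of_not_isOfFinAddOrder hκ hγ I s hnt
  obtain ⟨hiM, hcM, hiN⟩ := finite_coinvariants_of_charIdeal_le hYtors htors hchar hfinN
  have hdvd := natCard_coinvariants_mul_dvd_of_charIdeal_le hYtors htors hchar hfinN
  rw [Kato2004.natCard_invariants_quotient_span_eq_one s hs0 hiN, mul_one,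
    Kato2004.natCard_coinvariants_quotient_span s] at hdvd
  have hD := Y.isDualPair hγ
  refine ⟨hD.finite_coinvariants_iff.mp hcM, hD.finite_invariants_iff.mp hiM,
    ReducibleFineSelmerDescentCount.finite_descentCokernel_of_not_isOfFinAddOrder hκ hγ I s hnt,
    ReducibleFineSelmerDescentCount.finite_quotient_span_of_not_isOfFinAddOrder I s hnt, ?_⟩
  rw [hD.natCard_coinvariants, hD.natCard_invariants] at hdvd
  rw [ReducibleFineSelmerDescentCount.natCard_quotient_span_eq_natCard_descentCokernel_mul hκ hγ I s,
    mul_left_comm _ (Nat.card I.descentCokernel), mul_comm _ (Nat.card I.descentCokernel)]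
  exact mul_dvd_mul_left _ hdvd

/-- **The same at LEVEL 0, `μ`-free hypotheses**:
`#Sel₀(ℚ, W[p^∞]) · #(H¹(ℤ[1/p],T_pW)/proj₀(𝐇¹_Γ/T)) ∣ #W[p^∞]^{Γ_ℚ} · #Sel₀(W/ℚ_∞)_Γ · [H¹(ℤ[1/p],T_pW) : ℤ_p s₀]`.
[cite: Kato2004Asterisque, Thm. 14.5 (3) (p. 236), §14.14 (pp. 243–244)] [cite: GreenbergLNM1716, §4 Lemmas 4.2–4.3 (pp. 102–103)] -/
theorem natCard_fineSelmerZero_mul_descentCokernel_dvd_of_charIdeal_le' (hκ : κ.IsCyclotomic)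
    (hγ : κ.IsTopGenerator γ) (I : IwasawaH1Data W p κ γ) (Y : W.FineSelmerDualData κ γ)
    (hYtors : Module.IsTorsion (IwasawaAlgebra p) Y.X) (s : I.H) (hnt : ¬ IsOfFinAddOrder (I.proj 0 s))
    (hchar : Module.charIdeal (IwasawaAlgebra p) (I.H ⧸ Submodule.span (IwasawaAlgebra p) {s}) ≤
      Module.charIdeal (IwasawaAlgebra p) Y.X) :
    Nat.card (strictSelmerGroupOver (κ.layerSubgroup 0) (W.geomPrimaryTorsion p) p
        (fineData (W.geomPrimaryTorsion p) p)) * Nat.card I.descentCokernel ∣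
      Nat.card {m : W.geomPrimaryTorsion p | ∀ σ : absoluteGaloisGroup ℚ, σ • m = m} *
        Nat.card (EndCoinvariants (W.conjFineSelmerInfty κ γ - 1)) *
          Nat.card (integralH1 (tateRep W p) p (κ.layerSubgroup 0) ⧸
            Submodule.span ℤ_[p] {(⟨I.proj 0 s, I.proj_mem 0 s⟩ :
              integralH1 (tateRep W p) p (κ.layerSubgroup 0))}) := by
  have h1 := ReducibleFineSelmerLevelZero.natCard_fineSelmerZero_dvd_rat W κ γ
  rw [ReducibleFineSelmerLevelZero.setOf_fixed_layerZero_eq W p κ] at h1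
  obtain ⟨-, -, -, -, h2⟩ := natCard_fineSelmer_invariants_mul_descentCokernel_dvd_of_charIdeal_le' W p hκ hγ I Y
    hYtors s hnt hchar
  refine (mul_dvd_mul_right h1 _).trans ?_
  rw [mul_assoc, mul_assoc]
  exact mul_dvd_mul_left _ h2

end RowFree

/-! ## §2 Instance: the BIG-IMAGE rows (Kato's (12.5.2)), modulo the Thm. 13.4 fact alone -/

section BigImage

variable (W : WeierstrassCurve ℚ) [W.IsElliptic] (p : ℕ) [Fact p.Prime]
  [ContinuousSMul ℤ_[p] (W.tateModule p)] [Module.Free ℤ_[p] (W.tateModule p)]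
  [Module.Finite ℤ_[p] (W.tateModule p)]
  [Finite W.toAffine.Point] [Finite (AddCommGroup.primaryComponent W.sha p)]
  {κ : ZpExtension ℚ p} {γ : absoluteGaloisGroup ℚ}

/-- **Kato Thm. 14.5 (3) on the fine road, `Γ`-level and level 0, on the BIG-IMAGE rank-0 rows, modulo Thm. 13.4 ALONE.**
For `W/ℚ` elliptic with `Im ρ_{W,p} ⊇ SL₂(ℤ_p)` (`ImageContainsSL2`, Kato's (12.5.2)), `p ≠ 2`, `W(ℚ)` and `Ш(W)[p^∞]` finite, the
cyclotomic `(κ, γ)`, pinned `I`, any dual fine Selmer datum `Y`, and ANY genuine Λ-adic Euler-system class `s ∈ 𝐇¹_Γ(T_pW)` with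
`proj₀ s` of infinite order: `X₀` is torsion, `char_Λ(𝐇¹_Γ/Λs) ⊆ char_Λ X₀(W/ℚ_∞)` (Thm. 13.4 (3) at EVERY height-one prime —
no `μ`-input), and
`#Sel₀(W/ℚ_∞)^Γ · #(H¹(ℤ[1/p],T_pW)/proj₀(𝐇¹_Γ/T)) ∣ #Sel₀(W/ℚ_∞)_Γ · [H¹(ℤ[1/p],T_pW) : ℤ_p s₀]`,
`#Sel₀(ℚ, W[p^∞]) · #(H¹(ℤ[1/p],T_pW)/proj₀(𝐇¹_Γ/T)) ∣ #W[p^∞]^{Γ_ℚ} · #Sel₀(W/ℚ_∞)_Γ · [H¹(ℤ[1/p],T_pW) : ℤ_p s₀]`.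
[cite: Kato2004Asterisque, Thm. 12.5 (4) with (12.5.2) (p. 222), Thm. 13.4 (3) (p. 226), Thm. 14.5 (3) (p. 236), §14.14 (pp. 243–244)]
[cite: GreenbergLNM1716, §4 Lemmas 4.2–4.3 (pp. 102–103)] -/
theorem natCard_fineSelmer_mul_descentCokernel_dvd_of_imageContainsSL2
    (h134 : thm13_4_lengthAt_fineSelmerDual_le_of_isEulerSystemClass)
    (hp : p ≠ 2) (hκ : κ.IsCyclotomic) (hγ : κ.IsTopGenerator γ) (hSL2 : ImageContainsSL2 W p)
    (I : IwasawaH1Data W p κ γ) (Y : W.FineSelmerDualData κ γ) (s : I.H) (hs : IsEulerSystemClass W p κ γ I s)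
    (hnt : ¬ IsOfFinAddOrder (I.proj 0 s)) :
    Module.IsTorsion (IwasawaAlgebra p) Y.X ∧
      Module.charIdeal (IwasawaAlgebra p) (I.H ⧸ Submodule.span (IwasawaAlgebra p) {s}) ≤
        Module.charIdeal (IwasawaAlgebra p) Y.X ∧
      (Nat.card (endInvariants (W.conjFineSelmerInfty κ γ - 1)) * Nat.card I.descentCokernel ∣
        Nat.card (EndCoinvariants (W.conjFineSelmerInfty κ γ - 1)) *
          Nat.card (integralH1 (tateRep W p) p (κ.layerSubgroup 0) ⧸
            Submodule.span ℤ_[p] {(⟨I.proj 0 s, I.proj_mem 0 s⟩ :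
              integralH1 (tateRep W p) p (κ.layerSubgroup 0))})) ∧
      Nat.card (strictSelmerGroupOver (κ.layerSubgroup 0) (W.geomPrimaryTorsion p) p
          (fineData (W.geomPrimaryTorsion p) p)) * Nat.card I.descentCokernel ∣
        Nat.card {m : W.geomPrimaryTorsion p | ∀ σ : absoluteGaloisGroup ℚ, σ • m = m} *
          Nat.card (EndCoinvariants (W.conjFineSelmerInfty κ γ - 1)) *
            Nat.card (integralH1 (tateRep W p) p (κ.layerSubgroup 0) ⧸
              Submodule.span ℤ_[p] {(⟨I.proj 0 s, I.proj_mem 0 s⟩ :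
                integralH1 (tateRep W p) p (κ.layerSubgroup 0))}) := by
  have hs0 : s ≠ 0 := by
    rintro rfl
    exact hnt (by rw [map_zero]; exact isOfFinAddOrder_iff_nsmul_eq_zero.mpr ⟨1, one_pos, by simp⟩)
  haveI : Module.Finite (IwasawaAlgebra p) I.H := IwasawaH1Data.module_finite_of_isCyclotomic hκ hγ I
  haveI := I.noZeroSMulDivisors hγ
  have htors : Module.IsTorsion (IwasawaAlgebra p) (I.H ⧸ Submodule.span (IwasawaAlgebra p) {s}) :=
    ReducibleZetaDivisibility.isTorsion_quotient_span_singleton_of_ne_zero W p hκ hγ I hs0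
  haveI : Module.Finite (IwasawaAlgebra p) Y.X := FineSelmerDualData.module_finite W κ hγ Y
  -- Kato's `σ` for clause (3) (and for hypothesis (v)) from (12.5.2)
  obtain ⟨σ, hσ, ⟨e⟩⟩ := exists_quotient_range_sub_one_equiv_of_imageContainsSL2 W p hSL2
  have hv : ∃ σ : absoluteGaloisGroup ℚ, (∀ (n : ℕ) (t : AlgebraicClosure ℚ), t ^ p ^ n = 1 → σ • t = t) ∧
      Module.finrank ℤ_[p] ((W.tateModule p) ⧸ LinearMap.range (W.galoisRepTate p σ - 1)) = 1 :=
    ⟨σ, hσ, by rw [e.finrank_eq, Module.finrank_self]⟩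
  have hirr : W.HasIrreducibleModPGaloisRep p :=
    hasIrreducibleModPGaloisRep_of_hasSurjectiveModNGaloisRep W p
      (hasSurjectiveModNGaloisRep_of_imageContainsSL2 W p hSL2)
  have h3 := (h134 W p κ γ hp hκ hγ I Y s hs hs0 hv).2 hirr ⟨σ, hσ, ⟨e⟩⟩
  have hYtors : Module.IsTorsion (IwasawaAlgebra p) Y.X :=
    isTorsion_fineSelmerDual_of_thm13_4 h134 hp hκ hγ I Y hs hs0 hv htors
  have hchar : Module.charIdeal (IwasawaAlgebra p) (I.H ⧸ Submodule.span (IwasawaAlgebra p) {s}) ≤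
      Module.charIdeal (IwasawaAlgebra p) Y.X :=
    Kim2025.charIdeal_le_charIdeal_of_lengthAt_le htors hYtors h3
  exact ⟨hYtors, hchar,
    (natCard_fineSelmer_invariants_mul_descentCokernel_dvd_of_charIdeal_le' W p hκ hγ I Y hYtors s hnt hchar).2.2.2.2,
    natCard_fineSelmerZero_mul_descentCokernel_dvd_of_charIdeal_le' W p hκ hγ I Y hYtors s hnt hchar⟩

end BigImage

end Summit.BirchSwinnertonDyer.BirchSwinnertonDyer.Theorems.FineSelmerDescentOfDivisibility

end
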